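import Summits.BirchSwinnertonDyer.Rank1Residual.Iwasawa.LambdaInvariantZeroSet
import HarnessLib

/-!
# Accounting over ALL vanishing layers: `r + Σ_{n ∈ S} φ(pⁿ⁺¹) ≤ λ(G)`, so at most
# `log_p(λ(G) − r + 1)` conductors carry a vanishing Birch sum; and vanishing is a property of the
# conductor, not of the character
# (cell `b2b-bsdres`; class-agnostic kernel support for the (μ, λ) censuses of iw-1 / iw-2; prover
# unit `b2b-bsdres-additive-p3`, gen 8)

HONEST FRAMING (run/shared/lean/b2b/bsd-rank1-residual/, verbatim in every file): the goal of the
cell is to DELETE the COMBINATION-SHAPED residual classes of the Birch–Swinnerton-Dyer formula for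
ALL analytic-rank `≤ 1` elliptic curves over `ℚ` — "full BSD formula for every rank `≤ 1` curve in
class `C`" assembled STRICTLY from published theorems — so that the rank-`≤ 1` remainder becomes
exactly the CONSTRUCTION-SHAPED classes, which are TYPED (missing-input `Prop`s), NOT attempted.
This is not "finishing BSD". THEOREMS ONLY; no named fact; nothing about any curve is asserted;
nothing booked; no label changes.

## What this file proves

The sibling file `Iwasawa/LambdaInvariantZeroSet.lean` (gen 8) shows that `λ(G)` is the number of
zeros of `G ∈ Λ ∖ {0}` in the open unit disc of `ℂ_p` and that a vanishing layer contributes a full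
Galois orbit. Consequences:

* §1 (algebra) `sum_totient_le_lam` / `add_sum_totient_le_lam_of_X_pow_dvd`: if `T^r ∣ G ≠ 0` and
  `G(ζ_n − 1) = 0` for some `ζ_n` of order `pⁿ⁺¹` for every `n` in a finite set `S`, then
  `r + Σ_{n ∈ S} φ(pⁿ⁺¹) ≤ λ(G)`; since the `k` cheapest layers cost `p^k − 1`
  (`pow_card_le_one_add_sum_totient`), `r + p^{#S} ≤ λ(G) + 1` (`add_pow_card_le_lam_succ_of_X_pow_dvd`):
  at most `log_p(λ(G) − r + 1)` vanishing layers. (Gen 7, p220754, had the one-layer inequality.)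
* §2 (`p`-adic side) for `L ∈ ℚ_p⟦T⟧` with the twisted Mazur–Tate–Teitelbaum interpolation clause
  for `(f, α)` and an integral model `ι(G) = ϖ·L`, `T^r ∣ G ≠ 0`: the set `S` of layers `n` with a
  vanishing Birch sum `∑_a χ(a)[a/p^{n+1+e₀}]⁺_f = 0` (some primitive even `p`-power-order `χ` of that
  conductor) obeys the same bounds (`add_sum_totient_le_lam_of_ratTwistedSymbolSum_eq_zero`,
  `add_pow_card_le_lam_succ_of_ratTwistedSymbolSum_eq_zero`); and for `α ≠ 0` vanishing is a property
  of the CONDUCTOR: `Birch(χ) = 0 ↔ Birch(χ') = 0` for any two such characters of the same conductor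
  (`ratTwistedSymbolSum_eq_zero_iff_of_level_eq` — a `p`-adic proof of a Galois-conjugacy statement).

The complex side (`L(E, χ, 1) = 0` for few conductors) and the instances on tree objects (good
ordinary / multiplicative `p`, Mazur–Tate elements at supersingular `p`) are in the sibling file
`Iwasawa/LambdaInvariantZeroSetTwisted.lean`.

References: [Washington1997] §7.1–7.2; [MazurTateTeitelbaum1986Invent] §I.8 (8.6), §I.12–I.15;
HOME/b2b-bsdres-additive-p3/X8-ROUTE-B.md §13 (gen 8).
-/

set_option autoImplicit false

noncomputable section

open scoped Classical MatrixGroups ModularForm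

open CongruenceSubgroup Polynomial WeierstrassCurve Literature.NumberTheory.EllipticCurves
  Literature.NumberTheory.EllipticCurves.ModularForms
  Literature.NumberTheory.EllipticCurves.GreenbergVatsal2000
  Summit.BirchSwinnertonDyer.Rank1Residual.X1.MuLambda
  Summit.BirchSwinnertonDyer.Rank1Residual.X11a
  Summit.BirchSwinnertonDyer.Rank1Residual.Supersingular

namespace Summit.BirchSwinnertonDyer.Rank1Residual.Iwasawa

variable {p : ℕ} [hp : Fact p.Prime]

/-! ## §1. Accounting over all vanishing layers: `r + Σ_{n ∈ S} φ(pⁿ⁺¹) ≤ λ(G)` -/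

section Layers

/-- A `p`-power root of unity `ζ` of order `pⁿ⁺¹` has `ζ ≠ 1`, i.e. `ζ − 1 ≠ 0`. [folklore] -/
theorem sub_one_ne_zero_of_isPrimitiveRoot {n : ℕ} {ζ : ℂ_[p]}
    (hζ : IsPrimitiveRoot ζ (p ^ (n + 1))) : ζ - 1 ≠ 0 := by
  rw [sub_ne_zero]
  intro h1
  have hone : (p ^ (n + 1) : ℕ) = 1 := hζ.eq_orderOf.trans (by rw [h1, orderOf_one])
  have : 1 < p ^ (n + 1) := Nat.one_lt_pow (Nat.succ_ne_zero n) hp.out.one_lt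
  omega

/-- **All vanishing layers at once.** Let `G ∈ Λ ∖ {0}` and let `S` be a finite set of layers such
that for every `n ∈ S` the power series `G` vanishes at `ζ_n − 1` for SOME primitive `pⁿ⁺¹`-th root
of unity `ζ_n ∈ ℂ_p`. Then `Σ_{n ∈ S} φ(pⁿ⁺¹) ≤ λ(G)`: by §4 each such layer contributes all
`φ(pⁿ⁺¹)` points `ζ − 1`, `ζ` of order `pⁿ⁺¹`, these sets are disjoint for distinct `n`, and §3
bounds any set of distinct zeros by `λ(G)`. No hypothesis on `μ(G)`.
[cite: Washington1997, §7.1–7.2 and Thm. 7.3] -/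
theorem sum_totient_le_lam {G : IwasawaAlgebra p} (hG0 : G ≠ 0) (S : Finset ℕ)
    (hS : ∀ n ∈ S, ∃ ζ : ℂ_[p], IsPrimitiveRoot ζ (p ^ (n + 1)) ∧
      HasSum (fun k ↦ ((algebraMap ℚ_[p] ℂ_[p]).comp (algebraMap ℤ_[p] ℚ_[p]))
        (PowerSeries.coeff k G) * (ζ - 1) ^ k) 0) :
    ∑ n ∈ S, Nat.totient (p ^ (n + 1)) ≤ lam G := by
  have hP : p.Prime := hp.out
  -- the orbit of layer `n`, shifted by `−1`
  set orb : ℕ → Finset ℂ_[p] := fun n ↦ (primitiveRoots (p ^ (n + 1)) ℂ_[p]).image (· - 1)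
    with horb
  have hinj : Function.Injective (fun x : ℂ_[p] ↦ x - 1) := sub_left_injective
  have hcard : ∀ n ∈ S, (orb n).card = Nat.totient (p ^ (n + 1)) := by
    intro n hn
    obtain ⟨ζ, hζ, -⟩ := hS n hn
    rw [horb, Finset.card_image_of_injective _ hinj, hζ.card_primitiveRoots]
  have hdisj : (S : Set ℕ).PairwiseDisjoint orb := by
    intro n _ m _ hnm
    change Disjoint (orb n) (orb m)
    rw [horb, Finset.disjoint_image hinj]
    exact IsPrimitiveRoot.disjoint fun h ↦ hnm (Nat.succ_injective (Nat.pow_right_injective hP.two_le h))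
  have hZ : ∀ z ∈ S.biUnion orb, ‖z‖ < 1 ∧ HasSum (fun k ↦ ((algebraMap ℚ_[p] ℂ_[p]).comp
      (algebraMap ℤ_[p] ℚ_[p])) (PowerSeries.coeff k G) * z ^ k) 0 := by
    intro z hz
    rw [Finset.mem_biUnion] at hz
    obtain ⟨n, hn, hzn⟩ := hz
    rw [horb, Finset.mem_image] at hzn
    obtain ⟨ζ', hζ'mem, rfl⟩ := hzn
    have hζ' : IsPrimitiveRoot ζ' (p ^ (n + 1)) :=
      (mem_primitiveRoots (pow_pos hP.pos _)).mp hζ'mem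
    obtain ⟨ζ, hζ, hsum⟩ := hS n hn
    exact ⟨norm_sub_one_lt_one_of_pow_prime_pow_eq_one (j := n + 1) hζ'.pow_eq_one,
      (hasSum_zero_iff_of_isPrimitiveRoot G hζ hζ').mp hsum⟩
  calc ∑ n ∈ S, Nat.totient (p ^ (n + 1)) = ∑ n ∈ S, (orb n).card :=
        Finset.sum_congr rfl fun n hn ↦ (hcard n hn).symm
    _ = (S.biUnion orb).card := (Finset.card_biUnion hdisj).symm
    _ ≤ lam G := card_le_lam_of_forall_hasSum_zero hG0 _ hZ

/-- **Accounting with the order of vanishing at `T = 0`**: if moreover `T^r ∣ G`, then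
`r + Σ_{n ∈ S} φ(pⁿ⁺¹) ≤ λ(G)` (`G = T^r G₀`, `λ(G) = r + λ(G₀)`, and the cyclotomic zeros
`ζ − 1 ≠ 0` are zeros of `G₀`). This is the simultaneous form of p220754's
`add_totient_le_lam_of_X_pow_dvd` (one layer). [cite: Washington1997, §7.1–7.2 and Thm. 7.3] -/
theorem add_sum_totient_le_lam_of_X_pow_dvd {G : IwasawaAlgebra p} (hG0 : G ≠ 0) {r : ℕ}
    (hX : (PowerSeries.X : IwasawaAlgebra p) ^ r ∣ G) (S : Finset ℕ)
    (hS : ∀ n ∈ S, ∃ ζ : ℂ_[p], IsPrimitiveRoot ζ (p ^ (n + 1)) ∧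
      HasSum (fun k ↦ ((algebraMap ℚ_[p] ℂ_[p]).comp (algebraMap ℤ_[p] ℚ_[p]))
        (PowerSeries.coeff k G) * (ζ - 1) ^ k) 0) :
    r + ∑ n ∈ S, Nat.totient (p ^ (n + 1)) ≤ lam G := by
  obtain ⟨G₀, rfl⟩ := hX
  have hG₀ : G₀ ≠ 0 := fun h ↦ hG0 (by rw [h, mul_zero])
  have hS₀ : ∀ n ∈ S, ∃ ζ : ℂ_[p], IsPrimitiveRoot ζ (p ^ (n + 1)) ∧
      HasSum (fun k ↦ ((algebraMap ℚ_[p] ℂ_[p]).comp (algebraMap ℤ_[p] ℚ_[p]))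
        (PowerSeries.coeff k G₀) * (ζ - 1) ^ k) 0 := by
    intro n hn
    obtain ⟨ζ, hζ, hsum⟩ := hS n hn
    have hz : ‖ζ - 1‖ < 1 := norm_sub_one_lt_one_of_pow_prime_pow_eq_one (j := n + 1) hζ.pow_eq_one
    exact ⟨ζ, hζ, (hasSum_zero_X_pow_mul_iff r hz (sub_one_ne_zero_of_isPrimitiveRoot hζ)).mp hsum⟩
  rw [lam_X_pow_mul_eq_add hG₀]
  exact Nat.add_le_add_left (sum_totient_le_lam hG₀ S hS₀) r

/-- The `k` cheapest layers cost `p^k − 1`: for any finite set `S` of natural numbers,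
`p^{#S} − 1 ≤ Σ_{n ∈ S} φ(pⁿ⁺¹)` (equivalently `p^{#S} ≤ 1 + Σ`), since the `i`-th smallest
element of `S` is `≥ i` and `Σ_{i<k} φ(p^{i+1}) = p^k − 1`. [folklore] -/
theorem pow_card_le_one_add_sum_totient (S : Finset ℕ) :
    p ^ S.card ≤ 1 + ∑ n ∈ S, Nat.totient (p ^ (n + 1)) := by
  have hP : p.Prime := hp.out
  induction S using Finset.induction_on_max with
  | empty => simp
  | insert a s hlt ih =>
    have ha : a ∉ s := fun h ↦ lt_irrefl a (hlt a h)
    rw [Finset.card_insert_of_notMem ha, Finset.sum_insert ha, pow_succ]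
    -- `#s ≤ a` because `s ⊆ {0, …, a-1}`
    have hsa : s.card ≤ a := by
      calc s.card ≤ (Finset.range a).card :=
            Finset.card_le_card fun x hx ↦ Finset.mem_range.mpr (hlt x hx)
        _ = a := Finset.card_range a
    -- `φ(p^{a+1}) ≥ φ(p^{#s+1}) = p^{#s} (p-1)`
    have hmono : p ^ s.card * (p - 1) ≤ Nat.totient (p ^ (a + 1)) := by
      rw [Nat.totient_prime_pow_succ hP]
      exact Nat.mul_le_mul_right _ (Nat.pow_le_pow_right hP.pos hsa)
    calc p ^ s.card * p = p ^ s.card * (p - 1) + p ^ s.card := by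
          rw [Nat.mul_sub_one, Nat.sub_add_cancel (Nat.le_mul_of_pos_right _ hP.pos)]
      _ ≤ Nat.totient (p ^ (a + 1)) + (1 + ∑ n ∈ s, Nat.totient (p ^ (n + 1))) :=
          Nat.add_le_add hmono ih
      _ = 1 + (Nat.totient (p ^ (a + 1)) + ∑ n ∈ s, Nat.totient (p ^ (n + 1))) := by ring

/-- **The number of vanishing layers is at most `log_p (λ(G) − r + 1)`**: under the hypotheses of
`add_sum_totient_le_lam_of_X_pow_dvd`, `r + p^{#S} ≤ λ(G) + 1`.
[cite: Washington1997, §7.1–7.2 and Thm. 7.3] -/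
theorem add_pow_card_le_lam_succ_of_X_pow_dvd {G : IwasawaAlgebra p} (hG0 : G ≠ 0) {r : ℕ}
    (hX : (PowerSeries.X : IwasawaAlgebra p) ^ r ∣ G) (S : Finset ℕ)
    (hS : ∀ n ∈ S, ∃ ζ : ℂ_[p], IsPrimitiveRoot ζ (p ^ (n + 1)) ∧
      HasSum (fun k ↦ ((algebraMap ℚ_[p] ℂ_[p]).comp (algebraMap ℤ_[p] ℚ_[p]))
        (PowerSeries.coeff k G) * (ζ - 1) ^ k) 0) :
    r + p ^ S.card ≤ lam G + 1 := by
  have h1 := add_sum_totient_le_lam_of_X_pow_dvd hG0 hX S hS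
  have h2 := pow_card_le_one_add_sum_totient (p := p) S
  omega

/-- **Each vanishing layer costs at least `p − 1`**: `r + #S · (p − 1) ≤ λ(G)`.
[cite: Washington1997, §7.1–7.2 and Thm. 7.3] -/
theorem add_card_mul_le_lam_of_X_pow_dvd {G : IwasawaAlgebra p} (hG0 : G ≠ 0) {r : ℕ}
    (hX : (PowerSeries.X : IwasawaAlgebra p) ^ r ∣ G) (S : Finset ℕ)
    (hS : ∀ n ∈ S, ∃ ζ : ℂ_[p], IsPrimitiveRoot ζ (p ^ (n + 1)) ∧
      HasSum (fun k ↦ ((algebraMap ℚ_[p] ℂ_[p]).comp (algebraMap ℤ_[p] ℚ_[p]))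
        (PowerSeries.coeff k G) * (ζ - 1) ^ k) 0) :
    r + S.card * (p - 1) ≤ lam G := by
  have hP : p.Prime := hp.out
  have hle : S.card * (p - 1) ≤ ∑ n ∈ S, Nat.totient (p ^ (n + 1)) := by
    have h := Finset.card_nsmul_le_sum S (fun n ↦ Nat.totient (p ^ (n + 1))) (p - 1) fun n _ ↦ by
      rw [Nat.totient_prime_pow_succ hP]
      exact Nat.le_mul_of_pos_left _ (pow_pos hP.pos n)
    rwa [smul_eq_mul] at h
  exact le_trans (Nat.add_le_add_left hle r) (add_sum_totient_le_lam_of_X_pow_dvd hG0 hX S hS)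

end Layers

/-! ## §2. `p`-adic side: Birch sums with the twisted interpolation clause -/

section Twists

variable {N : ℕ} {f : CuspForm (Gamma0 N) 2}

/-- For a primitive even character `χ` of conductor `p^{n+1+e₀}` and `p`-power order with values in
`ℂ_p`, `ζ = χ(γ)` is a primitive `pⁿ⁺¹`-th root of unity (`orderOf_apply_cyclotomicGenerator`).
[cite: MazurTateTeitelbaum1986Invent, §I.13–I.14] -/
theorem isPrimitiveRoot_apply_cyclotomicGenerator {n : ℕ}
    (χ : DirichletCharacter ℂ_[p] (p ^ (n + 1 + cyclotomicExponent p))) (hχ : χ.IsPrimitive)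
    (heven : χ.Even) (hord : ∃ j : ℕ, orderOf χ = p ^ j) :
    IsPrimitiveRoot (χ (cyclotomicGenerator p : ZMod (p ^ (n + 1 + cyclotomicExponent p))))
      (p ^ (n + 1)) := by
  have hme : cyclotomicExponent p < n + 1 + cyclotomicExponent p := by omega
  have horder : orderOf (χ (cyclotomicGenerator p : ZMod (p ^ (n + 1 + cyclotomicExponent p)))) =
      p ^ (n + 1) := by
    rw [orderOf_apply_cyclotomicGenerator hme χ hχ heven hord, Nat.add_sub_cancel]
  rw [← horder]
  exact IsPrimitiveRoot.orderOf _

/-- **The integral model evaluates to the Birch sum**: with the twisted interpolation clause `hI`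
for `(f, α)` and `ι(G) = ϖ·L`, `∑_k G_k (χ(γ) − 1)^k = ϖ · α^{−m} · ∑_a χ(a)[a/p^m]⁺_f`.
[cite: MazurTateTeitelbaum1986Invent, §I.13–I.14] -/
theorem hasSum_integralModel_eq_ratTwistedSymbolSum {α : ℚ_[p]} {L : PowerSeries ℚ_[p]}
    (hI : ∀ (m : ℕ), 0 < m → ∀ χ : DirichletCharacter ℂ_[p] (p ^ m), χ.IsPrimitive → χ.Even →
      (∃ j : ℕ, orderOf χ = p ^ j) →
        HasSum (fun k : ℕ ↦ algebraMap ℚ_[p] ℂ_[p] (PowerSeries.coeff k L) *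
            (χ (cyclotomicGenerator p : ZMod (p ^ m)) - 1) ^ k)
          (algebraMap ℚ_[p] ℂ_[p] (α⁻¹ ^ m) * ratTwistedSymbolSum f χ))
    {G : IwasawaAlgebra p} {ϖ : ℚ_[p]} (hG : iwasawaToPowerSeries p G = PowerSeries.C ϖ * L)
    {m : ℕ} (hm : 0 < m) (χ : DirichletCharacter ℂ_[p] (p ^ m)) (hχ : χ.IsPrimitive)
    (heven : χ.Even) (hord : ∃ j : ℕ, orderOf χ = p ^ j) :
    HasSum (fun k ↦ ((algebraMap ℚ_[p] ℂ_[p]).comp (algebraMap ℤ_[p] ℚ_[p]))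
        (PowerSeries.coeff k G) * (χ (cyclotomicGenerator p : ZMod (p ^ m)) - 1) ^ k)
      (algebraMap ℚ_[p] ℂ_[p] ϖ * (algebraMap ℚ_[p] ℂ_[p] (α⁻¹ ^ m) * ratTwistedSymbolSum f χ)) := by
  have h := (hI m hm χ hχ heven hord).mul_left (algebraMap ℚ_[p] ℂ_[p] ϖ)
  refine h.congr_fun fun k ↦ ?_
  have hk : algebraMap ℤ_[p] ℚ_[p] (PowerSeries.coeff k G) = ϖ * PowerSeries.coeff k L := by
    have h1 := congr_arg (PowerSeries.coeff k) hG
    rw [iwasawaToPowerSeries, PowerSeries.coeff_map, PowerSeries.coeff_C_mul] at h1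
    exact h1
  show ((algebraMap ℚ_[p] ℂ_[p]).comp (algebraMap ℤ_[p] ℚ_[p])) (PowerSeries.coeff k G) *
      (χ (cyclotomicGenerator p : ZMod (p ^ m)) - 1) ^ k =
    algebraMap ℚ_[p] ℂ_[p] ϖ * (algebraMap ℚ_[p] ℂ_[p] (PowerSeries.coeff k L) *
      (χ (cyclotomicGenerator p : ZMod (p ^ m)) - 1) ^ k)
  rw [RingHom.comp_apply, hk, map_mul, mul_assoc]

/-- A vanishing Birch sum of conductor `p^m` makes the integral model vanish at `χ(γ) − 1`.
[cite: MazurTateTeitelbaum1986Invent, §I.13–I.14] -/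
theorem hasSum_zero_of_ratTwistedSymbolSum_eq_zero {α : ℚ_[p]} {L : PowerSeries ℚ_[p]}
    (hI : ∀ (m : ℕ), 0 < m → ∀ χ : DirichletCharacter ℂ_[p] (p ^ m), χ.IsPrimitive → χ.Even →
      (∃ j : ℕ, orderOf χ = p ^ j) →
        HasSum (fun k : ℕ ↦ algebraMap ℚ_[p] ℂ_[p] (PowerSeries.coeff k L) *
            (χ (cyclotomicGenerator p : ZMod (p ^ m)) - 1) ^ k)
          (algebraMap ℚ_[p] ℂ_[p] (α⁻¹ ^ m) * ratTwistedSymbolSum f χ))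
    {G : IwasawaAlgebra p} {ϖ : ℚ_[p]} (hG : iwasawaToPowerSeries p G = PowerSeries.C ϖ * L)
    {m : ℕ} (hm : 0 < m) {χ : DirichletCharacter ℂ_[p] (p ^ m)} (hχ : χ.IsPrimitive)
    (heven : χ.Even) (hord : ∃ j : ℕ, orderOf χ = p ^ j) (h0 : ratTwistedSymbolSum f χ = 0) :
    HasSum (fun k ↦ ((algebraMap ℚ_[p] ℂ_[p]).comp (algebraMap ℤ_[p] ℚ_[p]))
        (PowerSeries.coeff k G) * (χ (cyclotomicGenerator p : ZMod (p ^ m)) - 1) ^ k) 0 := by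
  have h := hasSum_integralModel_eq_ratTwistedSymbolSum hI hG hm χ hχ heven hord
  rwa [h0, mul_zero, mul_zero] at h

/-- Conversely (`α ≠ 0`, `G ≠ 0`): if the integral model vanishes at `χ(γ) − 1`, the Birch sum of
`χ` vanishes (`ϖ ≠ 0` because `ι(G) = ϖ·L ≠ 0`). [cite: MazurTateTeitelbaum1986Invent, §I.13–I.14] -/
theorem ratTwistedSymbolSum_eq_zero_of_hasSum_zero {α : ℚ_[p]} (hα : α ≠ 0) {L : PowerSeries ℚ_[p]}
    (hI : ∀ (m : ℕ), 0 < m → ∀ χ : DirichletCharacter ℂ_[p] (p ^ m), χ.IsPrimitive → χ.Even →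
      (∃ j : ℕ, orderOf χ = p ^ j) →
        HasSum (fun k : ℕ ↦ algebraMap ℚ_[p] ℂ_[p] (PowerSeries.coeff k L) *
            (χ (cyclotomicGenerator p : ZMod (p ^ m)) - 1) ^ k)
          (algebraMap ℚ_[p] ℂ_[p] (α⁻¹ ^ m) * ratTwistedSymbolSum f χ))
    {G : IwasawaAlgebra p} {ϖ : ℚ_[p]} (hG : iwasawaToPowerSeries p G = PowerSeries.C ϖ * L)
    (hG0 : G ≠ 0) {m : ℕ} (hm : 0 < m) {χ : DirichletCharacter ℂ_[p] (p ^ m)} (hχ : χ.IsPrimitive)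
    (heven : χ.Even) (hord : ∃ j : ℕ, orderOf χ = p ^ j)
    (hsum : HasSum (fun k ↦ ((algebraMap ℚ_[p] ℂ_[p]).comp (algebraMap ℤ_[p] ℚ_[p]))
        (PowerSeries.coeff k G) * (χ (cyclotomicGenerator p : ZMod (p ^ m)) - 1) ^ k) 0) :
    ratTwistedSymbolSum f χ = 0 := by
  have h := hasSum_integralModel_eq_ratTwistedSymbolSum hI hG hm χ hχ heven hord
  have heq := h.unique hsum
  -- `ϖ ≠ 0`
  have hϖ : ϖ ≠ 0 := by
    rintro rfl
    apply hG0
    apply iwasawaToPowerSeries_injective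
    rw [hG, map_zero, zero_mul, map_zero]
  have hϖ' : algebraMap ℚ_[p] ℂ_[p] ϖ ≠ 0 := (map_ne_zero_iff _ (algebraMap ℚ_[p] ℂ_[p]).injective).mpr hϖ
  have hα' : algebraMap ℚ_[p] ℂ_[p] (α⁻¹ ^ m) ≠ 0 :=
    (map_ne_zero_iff _ (algebraMap ℚ_[p] ℂ_[p]).injective).mpr (pow_ne_zero _ (inv_ne_zero hα))
  rcases mul_eq_zero.mp heq with h1 | h1
  · exact absurd h1 hϖ'
  · exact (mul_eq_zero.mp h1).resolve_left hα'

/-- **Vanishing of a Birch sum is a property of the CONDUCTOR, not of the character** (`p`-adic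
proof of a Galois-conjugacy statement): for `α ≠ 0`, an integral model `G ≠ 0`, and two primitive
even `p`-power-order characters `χ, χ'` of the same conductor `p^{n+1+e₀}` with values in `ℂ_p`,
`∑_a χ(a)[a/p^{n+1+e₀}]⁺_f = 0 ↔ ∑_a χ'(a)[a/p^{n+1+e₀}]⁺_f = 0` (`χ(γ)`, `χ'(γ)` are primitive
`pⁿ⁺¹`-th roots of unity, and `G` vanishes at one `ζ − 1` iff at all of that order).
[cite: MazurTateTeitelbaum1986Invent, §I.13–I.14] [cite: Washington1997, §7.1–7.2 and Thm. 7.3] -/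
theorem ratTwistedSymbolSum_eq_zero_iff_of_level_eq {α : ℚ_[p]} (hα : α ≠ 0)
    {L : PowerSeries ℚ_[p]}
    (hI : ∀ (m : ℕ), 0 < m → ∀ χ : DirichletCharacter ℂ_[p] (p ^ m), χ.IsPrimitive → χ.Even →
      (∃ j : ℕ, orderOf χ = p ^ j) →
        HasSum (fun k : ℕ ↦ algebraMap ℚ_[p] ℂ_[p] (PowerSeries.coeff k L) *
            (χ (cyclotomicGenerator p : ZMod (p ^ m)) - 1) ^ k)
          (algebraMap ℚ_[p] ℂ_[p] (α⁻¹ ^ m) * ratTwistedSymbolSum f χ))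
    {G : IwasawaAlgebra p} {ϖ : ℚ_[p]} (hG : iwasawaToPowerSeries p G = PowerSeries.C ϖ * L)
    (hG0 : G ≠ 0) {n : ℕ} {χ χ' : DirichletCharacter ℂ_[p] (p ^ (n + 1 + cyclotomicExponent p))}
    (hχ : χ.IsPrimitive) (heven : χ.Even) (hord : ∃ j : ℕ, orderOf χ = p ^ j)
    (hχ' : χ'.IsPrimitive) (heven' : χ'.Even) (hord' : ∃ j : ℕ, orderOf χ' = p ^ j) :
    ratTwistedSymbolSum f χ = 0 ↔ ratTwistedSymbolSum f χ' = 0 := by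
  have hm : 0 < n + 1 + cyclotomicExponent p := by omega
  have hζ := isPrimitiveRoot_apply_cyclotomicGenerator χ hχ heven hord
  have hζ' := isPrimitiveRoot_apply_cyclotomicGenerator χ' hχ' heven' hord'
  constructor
  · intro h0
    exact ratTwistedSymbolSum_eq_zero_of_hasSum_zero hα hI hG hG0 hm hχ' heven' hord'
      ((hasSum_zero_iff_of_isPrimitiveRoot G hζ hζ').mp
        (hasSum_zero_of_ratTwistedSymbolSum_eq_zero hI hG hm hχ heven hord h0))
  · intro h0
    exact ratTwistedSymbolSum_eq_zero_of_hasSum_zero hα hI hG hG0 hm hχ heven hord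
      ((hasSum_zero_iff_of_isPrimitiveRoot G hζ' hζ).mp
        (hasSum_zero_of_ratTwistedSymbolSum_eq_zero hI hG hm hχ' heven' hord' h0))

/-- **All vanishing Birch-sum layers at once**: `T^r ∣ G ≠ 0`, `ι(G) = ϖ·L` with the twisted
interpolation clause, and for every `n` in a finite set `S` some primitive even `p`-power-order `χ`
of conductor `p^{n+1+e₀}` with `∑_a χ(a)[a/p^{n+1+e₀}]⁺_f = 0`. Then `r + Σ_{n ∈ S} φ(pⁿ⁺¹) ≤ λ(G)`.
[cite: MazurTateTeitelbaum1986Invent, §I.13–I.14] [cite: Washington1997, §7.1–7.2 and Thm. 7.3] -/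
theorem add_sum_totient_le_lam_of_ratTwistedSymbolSum_eq_zero {α : ℚ_[p]} {L : PowerSeries ℚ_[p]}
    (hI : ∀ (m : ℕ), 0 < m → ∀ χ : DirichletCharacter ℂ_[p] (p ^ m), χ.IsPrimitive → χ.Even →
      (∃ j : ℕ, orderOf χ = p ^ j) →
        HasSum (fun k : ℕ ↦ algebraMap ℚ_[p] ℂ_[p] (PowerSeries.coeff k L) *
            (χ (cyclotomicGenerator p : ZMod (p ^ m)) - 1) ^ k)
          (algebraMap ℚ_[p] ℂ_[p] (α⁻¹ ^ m) * ratTwistedSymbolSum f χ))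
    {G : IwasawaAlgebra p} {ϖ : ℚ_[p]} (hG : iwasawaToPowerSeries p G = PowerSeries.C ϖ * L)
    (hG0 : G ≠ 0) {r : ℕ} (hX : (PowerSeries.X : IwasawaAlgebra p) ^ r ∣ G) (S : Finset ℕ)
    (hS : ∀ n ∈ S, ∃ χ : DirichletCharacter ℂ_[p] (p ^ (n + 1 + cyclotomicExponent p)),
      χ.IsPrimitive ∧ χ.Even ∧ (∃ j : ℕ, orderOf χ = p ^ j) ∧ ratTwistedSymbolSum f χ = 0) :
    r + ∑ n ∈ S, Nat.totient (p ^ (n + 1)) ≤ lam G := by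
  refine add_sum_totient_le_lam_of_X_pow_dvd hG0 hX S fun n hn ↦ ?_
  obtain ⟨χ, hχ, heven, hord, h0⟩ := hS n hn
  exact ⟨_, isPrimitiveRoot_apply_cyclotomicGenerator χ hχ heven hord,
    hasSum_zero_of_ratTwistedSymbolSum_eq_zero hI hG (by omega) hχ heven hord h0⟩

/-- **At most `log_p(λ(G) − r + 1)` conductors carry a vanishing Birch sum**: under the same
hypotheses `r + p^{#S} ≤ λ(G) + 1`.
[cite: MazurTateTeitelbaum1986Invent, §I.13–I.14] [cite: Washington1997, §7.1–7.2 and Thm. 7.3] -/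
theorem add_pow_card_le_lam_succ_of_ratTwistedSymbolSum_eq_zero {α : ℚ_[p]}
    {L : PowerSeries ℚ_[p]}
    (hI : ∀ (m : ℕ), 0 < m → ∀ χ : DirichletCharacter ℂ_[p] (p ^ m), χ.IsPrimitive → χ.Even →
      (∃ j : ℕ, orderOf χ = p ^ j) →
        HasSum (fun k : ℕ ↦ algebraMap ℚ_[p] ℂ_[p] (PowerSeries.coeff k L) *
            (χ (cyclotomicGenerator p : ZMod (p ^ m)) - 1) ^ k)
          (algebraMap ℚ_[p] ℂ_[p] (α⁻¹ ^ m) * ratTwistedSymbolSum f χ))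
    {G : IwasawaAlgebra p} {ϖ : ℚ_[p]} (hG : iwasawaToPowerSeries p G = PowerSeries.C ϖ * L)
    (hG0 : G ≠ 0) {r : ℕ} (hX : (PowerSeries.X : IwasawaAlgebra p) ^ r ∣ G) (S : Finset ℕ)
    (hS : ∀ n ∈ S, ∃ χ : DirichletCharacter ℂ_[p] (p ^ (n + 1 + cyclotomicExponent p)),
      χ.IsPrimitive ∧ χ.Even ∧ (∃ j : ℕ, orderOf χ = p ^ j) ∧ ratTwistedSymbolSum f χ = 0) :
    r + p ^ S.card ≤ lam G + 1 := by
  have h1 := add_sum_totient_le_lam_of_ratTwistedSymbolSum_eq_zero hI hG hG0 hX S hS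
  have h2 := pow_card_le_one_add_sum_totient (p := p) S
  omega

end Twists


end Summit.BirchSwinnertonDyer.Rank1Residual.Iwasawa

end
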